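import Summits.ABC.IUTFork.Cor312Remarks
import Summits.ABC.IUTFork.Cor312RemarksToy
import Summits.ABC.IUTFork.ForkCopies
import HarnessLib

/-!
# INSTANCE FORMS for four remark-level hypothesis binders of the fork skeleton
# (`Cor312Rmk.GeneralizedVolumes.Cor312`, `Cor312Rmk.Itw.Citw`, `Cor312Rmk.Toy.SpecialCase`, `Smm.Identified`)

PROOF-ONLY companion (no `def`, no `structure`, no `instance`, no notation; abc-iut cell, block F seat
abc-iut-f-056 gen 6, KEY row INST59E of director-abc g4 2026-08-27T08:16Z). Each of the four declarations
below is a PARAMETRISED `def … : Prop` of a record-only fork file — a predicate on a small structure of real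
numbers / propositions that print introduces as a TOY or TWO-NUMBER SUMMARY of the Corollary 3.12 step — whose
universal closure is REFUTED in the tree (`F6ForkDecisionsTop1.lean`, `Cor312InterfacesNonVacuity.lean`) and
whose satisfiability was so far recorded only as an `∃`-statement (`exists_cor312`, `exists_citw`,
`exists_specialCase`, `exists_identified`). This file adds the INSTANCE-FORM theorems — conclusion head =
the declaration itself, fully qualified, at an explicit instance — in two shapes per row:

* a CONDITIONAL instance over ALL parameters, naming the exact arithmetic/propositional condition under
  which the predicate holds (the content the `∀`-refuter's counterexample violates), and
* CLOSED instances at the numbers print itself uses or at the boundary case where the printed deduction is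
  attained (`λ = 1`; `h = ϵ`; `A = B`).

Rows (FACT-LIST ids of the abc-iut cell): F-1882 `Cor312Rmk.GeneralizedVolumes.Cor312` ([IUTchIII] Rmk
3.12.1 (ii) p. 186), F-1883 `Cor312Rmk.Itw.Citw` and F-1886 `Cor312Rmk.Toy.SpecialCase` ([IUTchIII] Rmk 3.12.2
(ii) pp. 188–191), F-1889 `Smm.Identified` (Mochizuki, Report 2018 §1 (Smm)).

HONEST FRAMING: an instance form certifies that OUR typed toy-level predicate holds at the stated numbers —
nothing about [IUTchIII] Theorem 3.11 / Corollary 3.12 or the genuine inter-universal objects; refuted-as-typed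
≠ refuted-in-print; typed ≠ proved; no side is taken on [IUTchIII] Cor. 3.12; nothing here asserts abc proved
or refuted.
-/

namespace Summit.ABC.IUTFork

/-! ## F-1882 `Cor312Rmk.GeneralizedVolumes.Cor312` — [IUTchIII] Rmk 3.12.1 (ii), `−λ·|log(q)| ≤ −|log(Θ)|` -/

namespace Cor312Rmk.GeneralizedVolumes

/-- **F-1882, conditional instance (all parameters).** The claim-form `−λ·|log(q)| ≤ −|log(Θ)|` of Rmk 3.12.1
(ii) holds for every record whose Θ-side number admits a LOWER estimate `C·|log(q)| ≤ −|log(Θ)|` with a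
constant `C ≥ −λ` — the converse bookkeeping of the row file's `neg_lam_le` ("the inequality `C_Θ ≥ −λ`",
p. 186 l. 34–35); `|log(q)| > 0` is the record's own field. The tree's `∀`-refuter `exists_not_cor312`
(`−|log(Θ)| := −2`, `|log(q)| := 1`, `λ = 1`) violates exactly this (`−2 < −1`).
[cite: Mochizuki2012, III Rmk 3.12.1 (ii) p.186] -/
theorem cor312_of_lower_estimate (V : GeneralizedVolumes) {C : ℝ} (hC : -(V.lam : ℝ) ≤ C)
    (h : C * V.absLogQ ≤ V.negLogTheta) :
    Summit.ABC.IUTFork.Cor312Rmk.GeneralizedVolumes.Cor312 V := by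
  unfold GeneralizedVolumes.Cor312
  have hq := V.absLogQ_pos
  nlinarith

/-- **F-1882, boundary instance (all parameters).** If the Θ-side number IS `−λ·|log(q)|` (the `λ`-th power of
the `q`-pilot volume, p. 186 l. 8–18: the generalized link raises the `q`-pilot to the power `λ`), the
claim-form holds with equality. [cite: Mochizuki2012, III Rmk 3.12.1 (ii) p.186] -/
theorem cor312_of_eq (V : GeneralizedVolumes) (h : V.negLogTheta = -(V.lam : ℝ) * V.absLogQ) :
    Summit.ABC.IUTFork.Cor312Rmk.GeneralizedVolumes.Cor312 V :=
  cor312_of_lower_estimate V le_rfl h.ge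

/-- **F-1882, closed instance at `λ = 1`** (p. 186 l. 17–18: Corollary 3.12 "corresponds to the case of
`λ = 1`"): the record `λ = 1`, `−|log(Θ)| = 0`, `|log(q)| = 1` — the numbers of the tree's `∃`-witness
`exists_cor312` (Cor312InterfacesNonVacuity) — satisfies the claim-form (`−1 ≤ 0`). PARAMETER-RECORD witness,
not the genuine log-volumes. [cite: Mochizuki2012, III Rmk 3.12.1 (ii) p.186] -/
theorem cor312_one_zero_one :
    Summit.ABC.IUTFork.Cor312Rmk.GeneralizedVolumes.Cor312 ⟨1, one_pos, 0, 1, one_pos⟩ :=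
  cor312_of_lower_estimate _ (C := 0) (by norm_num) (by norm_num)

/-- **F-1882, closed instance at a generalized exponent `λ = 1/2 < 1`** ("sharper, for `λ < 1`", p. 186
l. 36–37), boundary case `−|log(Θ)| = −λ·|log(q)| = −1/2`, `|log(q)| = 1`: the claim-form holds with equality
and `neg_lam_le`'s bound `C ≥ −λ` is attained at `C = −1/2`. PARAMETER-RECORD witness.
[cite: Mochizuki2012, III Rmk 3.12.1 (ii) p.186] -/
theorem cor312_half_boundary :
    Summit.ABC.IUTFork.Cor312Rmk.GeneralizedVolumes.Cor312 ⟨1 / 2, one_half_pos, -(1 / 2), 1, one_pos⟩ :=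
  cor312_of_eq _ (by push_cast; ring)

end Cor312Rmk.GeneralizedVolumes

/-! ## F-1883 `Cor312Rmk.Itw.Citw` — [IUTchIII] Rmk 3.12.2 (ii) (c^itw), "(q-itw. holds) ∧ (Θ-itw. holds)" -/

namespace Cor312Rmk.Itw

/-- **F-1883, conditional instance at the printed mechanism (b^toy)/(c^toy)** (p. 190 l. 13–36: "the use of the
abstract symbol «∗» … entirely unrelated to any copies of `ℝ`" and "the use of the distinct labels «q», «Θ»"
is what "renders the simultaneous consideration of the two assignments `λ_q`, `λ_Θ` valid … (∗ ↦ q(−h) ∈ qℝ)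
∧ (∗ ↦ Θ(−2h) ∈ Θℝ)"): for EVERY toy datum and every assignment `star` on the abstract symbol — a function on
the LABELS — realising both labelled values, the frame `q-itw. := «star q = −h»`, `Θ-itw. := «star Θ = −2h»`,
`Θ-itw./indets. := «star Θ ∈ ℝ_{≤−2h+ϵ}»` has `Citw`. The tree's `∀`-refuter `not_forall_citw` is the
IDENTIFIED-copies frame `Toy.itwAt x` (one real value for both labels), where (a^toy) `−h ≠ −2h` makes `Citw`
false; the existential forms are `exists_citw_labelled` / `exists_citw` (F6ForkDecisionsTop1).
[cite: Mochizuki2012, III Rmk 3.12.2 (ii) p.190] -/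
theorem citw_labelled (T : Toy) (star : Toy.Label → ℝ) (hq : star .q = Toy.forget T.lamQ)
    (hΘ : star .theta = Toy.forget T.lamTheta) :
    Summit.ABC.IUTFork.Cor312Rmk.Itw.Citw
      ⟨star .q = Toy.forget T.lamQ, star .theta = Toy.forget T.lamTheta, star .theta ∈ T.lamThetaInd⟩ :=
  ⟨hq, hΘ⟩

/-- **F-1883, closed instance**: the same frame at THE assignment `q ↦ −h`, `Θ ↦ −2h` of (a^toy) p. 190 l. 5
(`λ_q : ∗ ↦ q(−h)`, `λ_Θ : ∗ ↦ Θ(−2h)`), written as one function on the labels (`btoy_ctoy_simultaneous`), for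
every toy datum `T`. [cite: Mochizuki2012, III Rmk 3.12.2 (ii) p.190] -/
theorem citw_assignment (T : Toy) :
    Summit.ABC.IUTFork.Cor312Rmk.Itw.Citw
      ⟨(if Toy.Label.q = Toy.Label.q then Toy.forget T.lamQ else Toy.forget T.lamTheta) = Toy.forget T.lamQ,
        (if Toy.Label.theta = Toy.Label.q then Toy.forget T.lamQ else Toy.forget T.lamTheta) =
          Toy.forget T.lamTheta,
        (if Toy.Label.theta = Toy.Label.q then Toy.forget T.lamQ else Toy.forget T.lamTheta) ∈
          T.lamThetaInd⟩ :=
  citw_labelled T (fun a => if a = .q then Toy.forget T.lamQ else Toy.forget T.lamTheta) (if_pos rfl)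
    (if_neg (by decide))

end Cor312Rmk.Itw

/-! ## F-1886 `Cor312Rmk.Toy.SpecialCase` — [IUTchIII] Rmk 3.12.2 (ii) (e^toy)/(f^toy), `−h ∈ ℝ_{≤−2h+ϵ}` -/

namespace Cor312Rmk.Toy

/-- **F-1886, conditional instance (all parameters).** "«∗ ↦ −h» may be regarded as a special case of
«∗ ↦ ℝ_{≤−2h+ϵ}»" holds for exactly the toy data with `h ≤ ϵ` (row file's `specialCase_iff`: the supposition
is as strong as the bound (f^toy) draws from it, "`−h ≤ −2h + ϵ`, i.e., `h ≤ ϵ`", p. 191 l. 30–33); stated as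
the sufficient direction with the declaration as head. The `∀`-refuter `not_forall_specialCase` is `h = 2 >
1 = ϵ`. [cite: Mochizuki2012, III Rmk 3.12.2 (ii) p.191] -/
theorem specialCase_of_h_le (T : Toy) (h : T.h ≤ T.ε) :
    Summit.ABC.IUTFork.Cor312Rmk.Toy.SpecialCase T :=
  (specialCase_iff T).mpr h

/-- **F-1886, closed instance at the boundary `h = ϵ = 1`**: `−h = −1 ∈ ℝ_{≤−2h+ϵ} = ℝ_{≤−1}`; the printed
conclusion `ftoy_bound` (`h ≤ ϵ`) is attained. (The numbers of `exists_specialCase`.)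
[cite: Mochizuki2012, III Rmk 3.12.2 (ii) p.191] -/
theorem specialCase_one_one :
    Summit.ABC.IUTFork.Cor312Rmk.Toy.SpecialCase ⟨1, 1, one_pos, one_pos⟩ :=
  specialCase_of_h_le _ le_rfl

/-- **F-1886, closed instance with slack `h = 1 < 2 = ϵ`**: `−1 ∈ ℝ_{≤0}`.
[cite: Mochizuki2012, III Rmk 3.12.2 (ii) p.191] -/
theorem specialCase_one_two :
    Summit.ABC.IUTFork.Cor312Rmk.Toy.SpecialCase ⟨1, 2, one_pos, two_pos⟩ :=
  specialCase_of_h_le _ (by norm_num)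

end Cor312Rmk.Toy

/-! ## F-1889 `Smm.Identified` — Report 2018 §1 (Smm), "even if one takes `A = B`" -/

namespace Smm

/-- **F-1889, instance form on the diagonal (all `A > 0`).** Mochizuki's rendering of the simplification,
"the theory remains essentially unaffected even if one takes `A = B`": every diagonal pair `(A, A)`, `A > 0`,
is `Identified`. (What print DEDUCES at such pairs — "`A = B = 0`, in contradiction to the initial assumption"
once the Θ-link relation `−2B = −A` is imposed — is the row file's `identified_absurd`, closed form
`not_exists_identified_and_thetaLink` in F6ForkDecisionsTop1; the `∀`-refuter `not_forall_identified` is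
`A = 1 ≠ 1/2 = B`.) [cite: Mochizuki2019Report, §1 p. 2 (Smm)] -/
theorem identified_diag (a : ℝ) (ha : 0 < a) : Summit.ABC.IUTFork.Smm.Identified ⟨a, a, ha, ha⟩ := rfl

/-- **F-1889, closed instance `A = B = 1`** (the numbers of `exists_identified`).
[cite: Mochizuki2019Report, §1 p. 2 (Smm)] -/
theorem identified_one_one : Summit.ABC.IUTFork.Smm.Identified ⟨1, 1, one_pos, one_pos⟩ :=
  identified_diag 1 one_pos

end Smm

end Summit.ABC.IUTFork
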